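import Summits.Ventures.PercRepro.RankDistCumulative

/-!
# PercRepro — the cumulative shadow inequality on the TIGHT LAYER `|E| = p + q`: the bottom sets, the size
bounds, and the paving case (p9, gen 19)

The TIGHT LAYER of `(p, q)` is a finite matroid `M` of rank `p` on exactly `p + q` elements. There the bottom
sets `𝓑 = PerFlat.Uq M p q` (rank `q`, complement of rank `p`) are exactly the independent `q`-subsets of `E`
whose complement is a base (`mem_Uq_tight`) — the maximum common independent sets of `M` and its dual — and
every shadow set `A ∈ ∂_u 𝓑 = shadowLev M u 𝓑` has `u ≤ |A| ≤ u + q` (`ncard_le_of_mem_shadowLev_tight`).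

THE THEOREM (`shadowCumulative_of_paving_tight`): on the tight layer every PAVING matroid — every circuit has at
least `ρ(E)` elements, the hypothesis of `ThmN.c025_of_paving` — satisfies the cumulative shadow inequality
`ShadowCumulative M p q` of `RankDistCumulative` (the candidate row C-048), by a plain double count: every
`u`-subset of `E` with `q < u < p` is a shadow set (`choose_le_card_shadowLev_of_paving_tight`:
`C(p+q, u) ≤ s_u`), and every shadow set of rank `q` is a `q`-subset of `E`
(`card_shadowLev_le_choose_of_paving_tight`: `s_q ≤ C(p+q, q)`). Nothing here is a statement about any window of
the crux: the paving case of the row is an observation about a class of matroids, recorded in the tree's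
vocabulary.
-/

namespace PercRepro.RankDist

open Set Finset _root_.Matroid PercRepro.ThmH

variable {α : Type} [DecidableEq α] (M : Matroid α) [M.Finite]

omit [DecidableEq α] in
/-- The ground finset has `M.E.ncard` elements. -/
lemma card_gr : (gr M).card = M.E.ncard := by
  rw [← coe_gr M, Set.ncard_coe_finset]

omit [DecidableEq α] [M.Finite] in
/-- In a paving matroid (every circuit has at least `ρ(E)` elements) every subset of `E` with fewer than
`ρ(E)` elements is independent. -/
lemma indep_of_encard_lt_eRank (hpav : ∀ C, M.IsCircuit C → M.eRank ≤ C.encard) {X : Set α}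
    (hX : X ⊆ M.E) (hlt : X.encard < M.eRank) : M.Indep X := by
  by_contra hdep
  obtain ⟨C, hCX, hC⟩ := (show M.Dep X from ⟨hdep, hX⟩).exists_isCircuit_subset
  exact absurd ((hpav C hC).trans (Set.encard_le_encard hCX)) (not_le.2 hlt)

omit [DecidableEq α] in
/-- The rank of a subset of `E` is at most its cardinality (as a natural number). -/
lemma rk_le_ncard {A : Set α} (hA : A ⊆ M.E) : rk M A ≤ A.ncard := by
  have hfin : A.Finite := M.ground_finite.subset hA
  have h := M.eRk_le_encard A
  rw [eRk_eq_coe_rk M hA, ← hfin.cast_ncard_eq] at h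
  exact_mod_cast h

/-- **The bottom sets of the tight layer.** On a matroid of rank `p` with `p + q` elements, `B` is a bottom set
of `(p, q)` iff it is an independent `q`-subset of `E` whose complement is a base. -/
theorem mem_Uq_tight {p q : ℕ} (hn : (gr M).card = p + q) (hr : M.eRank = (p : ℕ∞)) {B : Finset α} :
    B ∈ PerFlat.Uq M p q ↔
      B ⊆ gr M ∧ M.Indep (B : Set α) ∧ B.card = q ∧ M.IsBase ((gr M \ B : Finset α) : Set α) := by
  rw [PerFlat.mem_Uq]
  constructor
  · rintro ⟨hBE, hB, hD⟩
    have hDE : ((gr M \ B : Finset α) : Set α) ⊆ M.E := by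
      rw [← coe_gr M]; exact Finset.coe_subset.2 Finset.sdiff_subset
    -- the complement has at most `p` elements and rank `p`: it is an independent spanning set, a base
    have hDcard : (gr M \ B).card + B.card = p + q := by rw [card_sdiff_add_card_eq_card hBE, hn]
    have hBle : (B.card : ℕ∞) ≥ (q : ℕ∞) := by
      have := M.eRk_le_encard (B : Set α)
      rwa [hB, Set.encard_coe_eq_coe_finsetCard] at this
    have hDle : ((gr M \ B).card : ℕ∞) ≥ (p : ℕ∞) := by
      have := M.eRk_le_encard ((gr M \ B : Finset α) : Set α)
      rwa [hD, Set.encard_coe_eq_coe_finsetCard] at this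
    have hBq : B.card = q := by
      have h1 : q ≤ B.card := by exact_mod_cast hBle
      have h2 : p ≤ (gr M \ B).card := by exact_mod_cast hDle
      omega
    have hDp : (gr M \ B).card = p := by omega
    have hDind : M.Indep ((gr M \ B : Finset α) : Set α) := by
      rw [indep_iff_eRk_eq_encard, hD, Set.encard_coe_eq_coe_finsetCard, hDp]
    refine ⟨hBE, ?_, hBq, ?_⟩
    · rw [indep_iff_eRk_eq_encard, hB, Set.encard_coe_eq_coe_finsetCard, hBq]
    · exact hDind.isBase_of_eRk_ge (Finset.finite_toSet _) (by rw [hD, hr])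
  · rintro ⟨hBE, hBind, hBq, hD⟩
    refine ⟨hBE, ?_, ?_⟩
    · rw [hBind.eRk_eq_encard, Set.encard_coe_eq_coe_finsetCard, hBq]
    · rw [hD.eRk_eq_eRank, hr]

/-- On the tight layer a shadow set of rank `u` has at most `u + q` elements: its complement is contained in the
base complementary to a bottom set, hence independent of rank `≥ p − u`. -/
theorem ncard_le_of_mem_shadowLev_tight {p q u : ℕ} (hn : (gr M).card = p + q) (hr : M.eRank = (p : ℕ∞))
    {A : Set α} (hA : A ∈ shadowLev M u (PerFlat.Uq M p q)) : A.ncard ≤ u + q := by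
  rw [mem_shadowLev] at hA
  obtain ⟨hAE, hAu, B, hB, hBA⟩ := hA
  rw [mem_Uq_tight M hn hr] at hB
  obtain ⟨hBE, -, hBq, hD⟩ := hB
  have hfinA : A.Finite := M.ground_finite.subset hAE
  -- `E ∖ A ⊆ E ∖ B`, which is a base: so `E ∖ A` is independent
  have hsub : M.E \ A ⊆ ((gr M \ B : Finset α) : Set α) := by
    rw [Finset.coe_sdiff, coe_gr]
    exact Set.sdiff_subset_sdiff_right hBA
  have hind : M.Indep (M.E \ A) := hD.indep.subset hsub
  -- `ρ(E) ≤ ρ(A) + ρ(E ∖ A)`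
  have hsubmod : M.eRank ≤ M.eRk A + M.eRk (M.E \ A) := by
    have h := M.eRk_union_le_eRk_add_eRk A (M.E \ A)
    rwa [Set.union_sdiff_cancel hAE, eRk_eq_eRank (subset_refl _)] at h
  rw [hind.eRk_eq_encard, eRk_eq_coe_rk M hAE, hAu, hr, ← (M.ground_finite.sdiff).cast_ncard_eq,
    Set.ncard_sdiff hAE hfinA] at hsubmod
  have hAle : A.ncard ≤ M.E.ncard := Set.ncard_le_ncard hAE M.ground_finite
  have hE : M.E.ncard = p + q := by rw [← card_gr, hn]
  have h' : p ≤ u + (M.E.ncard - A.ncard) := by exact_mod_cast hsubmod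
  omega

omit [DecidableEq α] in
/-- On the tight layer a shadow set of rank `u` has at least `u` elements. -/
theorem le_ncard_of_mem_shadowLev {u : ℕ} {𝒜 : Finset (Finset α)} {A : Set α}
    (hA : A ∈ shadowLev M u 𝒜) : u ≤ A.ncard := by
  rw [mem_shadowLev] at hA
  obtain ⟨hAE, hAu, -⟩ := hA
  rw [← hAu]
  exact rk_le_ncard M hAE

/-- **Every `u`-subset of `E` is a shadow set (paving, tight layer).** For `q < u < p` on the tight layer of a
paving matroid, a `u`-subset `A` of `E` is independent (so of rank `u`), its complement has fewer than `p`
elements and extends to a base `β`, and `E ∖ β ⊆ A` is a bottom set. -/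
theorem coe_mem_shadowLev_of_paving_tight {p q u : ℕ} (hpav : ∀ C, M.IsCircuit C → M.eRank ≤ C.encard)
    (hn : (gr M).card = p + q) (hr : M.eRank = (p : ℕ∞)) (hqu : q < u) (hup : u < p)
    {A : Finset α} (hAE : A ⊆ gr M) (hAu : A.card = u) :
    (A : Set α) ∈ shadowLev M u (PerFlat.Uq M p q) := by
  have hAE' : (A : Set α) ⊆ M.E := by rw [← coe_gr M]; exact_mod_cast hAE
  -- `A` is independent
  have hAind : M.Indep (A : Set α) := by
    refine indep_of_encard_lt_eRank M hpav hAE' ?_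
    rw [Set.encard_coe_eq_coe_finsetCard, hAu, hr]; exact_mod_cast hup
  -- the complement `D` of `A` is independent: fewer than `p` elements
  have hDE : ((gr M \ A : Finset α) : Set α) ⊆ M.E := by
    rw [← coe_gr M]; exact Finset.coe_subset.2 Finset.sdiff_subset
  have hDcard : (gr M \ A).card = p + q - u := by rw [card_sdiff_of_subset hAE, hn, hAu]
  have hDind : M.Indep ((gr M \ A : Finset α) : Set α) := by
    refine indep_of_encard_lt_eRank M hpav hDE ?_
    rw [Set.encard_coe_eq_coe_finsetCard, hDcard, hr]; exact_mod_cast (by omega : p + q - u < p)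
  obtain ⟨β, hβ, hDβ⟩ := hDind.exists_isBase_superset
  have hβE : β ⊆ M.E := hβ.subset_ground
  have hβfin : β.Finite := M.ground_finite.subset hβE
  -- the bottom set `B = E ∖ β`, as a finset
  set βF : Finset α := hβfin.toFinset with hβF
  have hβFcoe : (βF : Set α) = β := hβfin.coe_toFinset
  have hβFE : βF ⊆ gr M := by
    intro x hx
    rw [hβF, hβfin.mem_toFinset] at hx
    rw [← Finset.mem_coe, coe_gr]; exact hβE hx
  have hβFcard : βF.card = p := by
    have h1 : (βF.card : ℕ∞) = (p : ℕ∞) := by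
      rw [← Set.encard_coe_eq_coe_finsetCard, hβFcoe, hβ.encard_eq_eRank, hr]
    exact_mod_cast h1
  set B : Finset α := gr M \ βF with hBdef
  have hBcoe : (B : Set α) = M.E \ β := by rw [hBdef, Finset.coe_sdiff, coe_gr, hβFcoe]
  have hBA : (B : Set α) ⊆ (A : Set α) := by
    rw [hBcoe]
    intro x hx
    by_contra hxA
    have hxD : x ∈ ((gr M \ A : Finset α) : Set α) := by
      rw [Finset.coe_sdiff, coe_gr]; exact ⟨hx.1, hxA⟩
    exact hx.2 (hDβ hxD)
  have hBmem : B ∈ PerFlat.Uq M p q := by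
    rw [mem_Uq_tight M hn hr]
    refine ⟨sdiff_subset, hAind.subset hBA, ?_, ?_⟩
    · rw [hBdef, card_sdiff_of_subset hβFE, hn, hβFcard]; omega
    · rw [hBdef, Finset.sdiff_sdiff_eq_self hβFE, hβFcoe]; exact hβ
  rw [mem_shadowLev]
  refine ⟨hAE', ?_, B, hBmem, hBA⟩
  rw [rk_eq_iff M hAE', hAind.eRk_eq_encard, Set.encard_coe_eq_coe_finsetCard, hAu]

/-- **`C(p+q, u) ≤ s_u` (paving, tight layer)** for `q < u < p`. -/
theorem choose_le_card_shadowLev_of_paving_tight {p q u : ℕ}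
    (hpav : ∀ C, M.IsCircuit C → M.eRank ≤ C.encard)
    (hn : (gr M).card = p + q) (hr : M.eRank = (p : ℕ∞)) (hqu : q < u) (hup : u < p) :
    (p + q).choose u ≤ (shadowLev M u (PerFlat.Uq M p q)).card := by
  rw [← hn, ← Finset.card_powersetCard]
  refine Finset.card_le_card_of_injOn (fun S : Finset α => (S : Set α)) ?_ ?_
  · intro S hS
    rw [Finset.mem_coe, Finset.mem_powersetCard] at hS
    exact coe_mem_shadowLev_of_paving_tight M hpav hn hr hqu hup hS.1 hS.2
  · intro S _ T _ hST
    exact Finset.coe_injective hST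

/-- **A shadow set of rank `q` is a `q`-subset of `E` (paving, tight layer, `q + 2 ≤ p`).** A set of rank `q`
with `q + 1` or more elements would contain an independent `(q + 1)`-subset. -/
theorem ncard_eq_of_mem_shadowLev_paving {p q : ℕ} (hpav : ∀ C, M.IsCircuit C → M.eRank ≤ C.encard)
    (hr : M.eRank = (p : ℕ∞)) (hqp : q + 2 ≤ p) {A : Set α}
    (hA : A ∈ shadowLev M q (PerFlat.Uq M p q)) : A.ncard = q := by
  rw [mem_shadowLev] at hA
  obtain ⟨hAE, hAq, -⟩ := hA
  have hfin : A.Finite := M.ground_finite.subset hAE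
  have hle : q ≤ A.ncard := by rw [← hAq]; exact rk_le_ncard M hAE
  by_contra hne
  have hlt : q + 1 ≤ A.ncard := by omega
  obtain ⟨S, hSA, hS⟩ := Set.exists_subset_encard_eq (s := A) (k := ((q + 1 : ℕ) : ℕ∞))
    (by rw [← hfin.cast_ncard_eq]; exact_mod_cast hlt)
  have hSind : M.Indep S := by
    refine indep_of_encard_lt_eRank M hpav (hSA.trans hAE) ?_
    rw [hS, hr]; exact_mod_cast (by omega : q + 1 < p)
  have h1 : M.eRk S ≤ M.eRk A := M.eRk_mono hSA
  rw [hSind.eRk_eq_encard, hS, eRk_eq_coe_rk M hAE, hAq] at h1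
  have h2 : q + 1 ≤ q := by exact_mod_cast h1
  omega

omit [DecidableEq α] in
open scoped Classical in
/-- The finset of the elements of `E` lying in `A ⊆ E`, as a set, is `A`. -/
lemma coe_filter_mem_gr {A : Set α} (hAE : A ⊆ M.E) :
    (((gr M).filter (fun e => e ∈ A) : Finset α) : Set α) = A := by
  ext x
  simp only [Finset.coe_filter, Set.mem_setOf_eq]
  constructor
  · rintro ⟨-, hx⟩; exact hx
  · intro hx; exact ⟨by rw [← Finset.mem_coe, coe_gr]; exact hAE hx, hx⟩

open scoped Classical in
/-- **`s_q ≤ C(p+q, q)` (paving, tight layer, `q + 2 ≤ p`).** -/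
theorem card_shadowLev_le_choose_of_paving_tight {p q : ℕ}
    (hpav : ∀ C, M.IsCircuit C → M.eRank ≤ C.encard)
    (hn : (gr M).card = p + q) (hr : M.eRank = (p : ℕ∞)) (hqp : q + 2 ≤ p) :
    (shadowLev M q (PerFlat.Uq M p q)).card ≤ (p + q).choose q := by
  rw [← hn, ← Finset.card_powersetCard]
  refine Finset.card_le_card_of_injOn (fun A : Set α => (gr M).filter (fun e => e ∈ A)) ?_ ?_
  · intro A hA
    rw [Finset.mem_coe] at hA
    have hAE : A ⊆ M.E := ((mem_shadowLev M).1 hA).1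
    have hcoe := coe_filter_mem_gr M hAE
    rw [Finset.mem_coe, Finset.mem_powersetCard]
    refine ⟨Finset.filter_subset _ _, ?_⟩
    rw [← Set.ncard_coe_finset, hcoe]
    exact ncard_eq_of_mem_shadowLev_paving M hpav hr hqp hA
  · intro A hA A' hA' hAA'
    rw [Finset.mem_coe] at hA hA'
    have hAE : A ⊆ M.E := ((mem_shadowLev M).1 hA).1
    have hAE' : A' ⊆ M.E := ((mem_shadowLev M).1 hA').1
    have h1 := coe_filter_mem_gr M hAE
    have h2 := coe_filter_mem_gr M hAE'
    have h3 : (((gr M).filter (fun e => e ∈ A) : Finset α) : Set α)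
        = (((gr M).filter (fun e => e ∈ A') : Finset α) : Set α) :=
      congrArg (fun S : Finset α => (S : Set α)) hAA'
    rwa [h1, h2] at h3

/-- **THE CUMULATIVE SHADOW INEQUALITY ON THE TIGHT LAYER OF A PAVING MATROID.** If `M` has rank `p`, exactly
`p + q` elements (`q + 2 ≤ p`) and every circuit of `M` has at least `p` elements, then `ShadowCumulative M p q`:
`s_q·C(p+q, u) ≤ C(p+q, q)·C(p+q, u) ≤ s_u·C(p+q, q)` for every `q < u < p`. -/
theorem shadowCumulative_of_paving_tight {p q : ℕ} (hpav : ∀ C, M.IsCircuit C → M.eRank ≤ C.encard)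
    (hn : (gr M).card = p + q) (hr : M.eRank = (p : ℕ∞)) (hqp : q + 2 ≤ p) :
    ShadowCumulative M p q := by
  intro u hqu hup
  calc (shadowLev M q (PerFlat.Uq M p q)).card * (p + q).choose u
      ≤ (p + q).choose q * (p + q).choose u :=
        Nat.mul_le_mul_right _ (card_shadowLev_le_choose_of_paving_tight M hpav hn hr hqp)
    _ = (p + q).choose u * (p + q).choose q := mul_comm _ _
    _ ≤ (shadowLev M u (PerFlat.Uq M p q)).card * (p + q).choose q :=
        Nat.mul_le_mul_right _ (choose_le_card_shadowLev_of_paving_tight M hpav hn hr hqu hup)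

/-- The corollary through `rls_of_shadowCumulative`: C-025 at `(p, q)` on the tight layer of a paving matroid
(also a special case of `ThmN.c025_of_paving`; recorded as the row's consequence). -/
theorem rls_of_paving_tight {p q : ℕ} (hpav : ∀ C, M.IsCircuit C → M.eRank ≤ C.encard)
    (hn : (gr M).card = p + q) (hr : M.eRank = (p : ℕ∞)) (hqp : q + 2 ≤ p) : ThmN.RLS M p q :=
  rls_of_shadowCumulative M p q (shadowCumulative_of_paving_tight M hpav hn hr hqp)

end PercRepro.RankDist
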